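import Summits.Ventures.PercRepro.RankLevelSetRuleQSliceBinom
import Summits.Ventures.PercRepro.RankLevelSetRuleQSliceTailGeneral
import Summits.Ventures.PercRepro.RankLevelSetRuleQUntruncated

/-!
# PercRepro — THE SLICE IDENTITY `L_u − Φ = 1 + ρ(2q+k, q) − ρ(2m+u, m) − T_u` FOR EVERY SLICE `u` (night-1, gen 21; dossier §32.1)

The borderline identity `border_sub_phiK_eq` (gen 20, `u = k − 2`) holds verbatim for every slice `u = q − m` of every family
`k ≥ 1`, with the untruncated lower bound `L_u = Σ_{0<j<k} C(u+k, j)·S_j(q, m) ≤ R̂(q, k, m)` (`rhatSliceL_le_rhat`) and the tail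
`T_u = sliceTail u k m = Σ_{k ≤ j ≤ u+k} C(u+k, j)·S_j(q, m)` (`q = m + u`):
* **`slice_sub_phiK_eq`** — `L_u − Φ(q+k, q) = 1 + ρ(2q+k, q) − ρ(2m+u, m) − T_u` (Pascal iterated: `L_u + T_u + S₀(q, m) =
  S₀(q, q+k)`, and `S₀(q, q+k) − Φ = 1 + ρ(2q+k, q)`);
* **`phiK_le_rhat_of_sliceTail`** — `T_u ≤ 1 + ρ(2q+k, q) − ρ(2m+u, m)` ⇒ `Φ(q+k, q) ≤ R̂(q, k, m)`, for every slice;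
* **`rhat_sub_phiK_eq_of_untrunc`** — on the untruncated slices `u ≥ k − 1` the identity is EXACT for `R̂` itself
  (`rhat_untrunc_eq`, p4): `R̂(q, k, m) − Φ(q+k, q) = 1 + ρ(2q+k, q) − ρ(2m+u, m) − T_u`; in particular `T_u(0) = ρ(2u+k, u)`.
With `sliceTail_succ_le` (`T_u(m+1) ≤ f(k)·T_u(m)`) this is the successor's handle on the untruncated half of the map.
Axioms: standard.
-/

namespace PercRepro

open Finset

/-- The untruncated lower bound of the slice `u`: `L_u(m) = Σ_{0<j<k} C(u+k, j) · Σ_{a ≤ m} C(m, a)/C(m+u+j+a, a+j)`. -/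
def sliceLower (u k m : ℕ) : ℚ :=
  ∑ j ∈ Finset.Ioo 0 k, ((u + k).choose j : ℚ)
    * ∑ a ∈ range (m + 1), (m.choose a : ℚ) / ((m + u + j + a).choose (a + j) : ℚ)

/-- `L_u ≤ R̂(q, k, m)` (`rhatSliceL_le_rhat` in the slice spelling). -/
lemma sliceLower_le_rhat (u k m : ℕ) : sliceLower u k m ≤ rhat (m + u) k m := by
  have h := rhatSliceL_le_rhat (m + u) k m
  rw [show m + u + k - m = u + k by omega] at h
  unfold sliceLower
  exact h

/-- **THE SLICE IDENTITY**: `L_u − Φ(q+k, q) = 1 + ρ(2q+k, q) − ρ(2m+u, m) − T_u` with `q = m + u` (`k ≥ 1`). -/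
theorem slice_sub_phiK_eq (u k m : ℕ) (hk : 1 ≤ k) :
    sliceLower u k m - phiK (m + u + k) (m + u)
      = 1 + (∑ i ∈ range (m + u + 1), ((2 * (m + u) + k).choose i : ℚ)) / ((2 * (m + u) + k).choose (m + u) : ℚ)
        - (∑ i ∈ range (m + 1), ((2 * m + u).choose i : ℚ)) / ((2 * m + u).choose m : ℚ)
        - sliceTail u k m := by
  -- the binomial sum over j ≤ u + k: L + T + S₀(q, m) = S₀(q, q + k)
  have hb := slice_binom_sum (m + u) m (u + k) 0
  simp only [zero_add] at hb
  -- split range (u + k + 1) = {0} ∪ Ico 1 k ∪ Ico k (u + k + 1)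
  have hsplit : ∑ j ∈ range (u + k + 1), ((u + k).choose j : ℚ)
        * ∑ a ∈ range (m + 1), (m.choose a : ℚ) / ((m + u + j + a).choose (a + j) : ℚ)
      = ∑ a ∈ range (m + 1), (m.choose a : ℚ) / ((m + u + 0 + a).choose (a + 0) : ℚ)
        + sliceLower u k m + sliceTail u k m := by
    unfold sliceLower sliceTail
    have h1 : Finset.Ioo 0 k = Finset.Ico 1 k := by ext j; simp only [Finset.mem_Ioo, Finset.mem_Ico]; omega
    have h2 : Finset.Icc k (u + k) = Finset.Ico k (u + k + 1) := by
      ext j; simp only [Finset.mem_Icc, Finset.mem_Ico]; omega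
    rw [h1, h2, Finset.range_eq_Ico,
      ← Finset.sum_Ico_consecutive _ (show 0 ≤ k by omega) (show k ≤ u + k + 1 by omega),
      ← Finset.sum_Ico_consecutive _ (show 0 ≤ 1 by omega) (show 1 ≤ k by omega)]
    rw [Finset.sum_Ico_succ_top (by omega : 0 ≤ 0 + 1 - 1)]
    simp only [Finset.Ico_self, Finset.sum_empty, Nat.choose_zero_right, Nat.cast_one, one_mul, zero_add,
      show 0 + 1 - 1 = 0 by rfl]
  rw [hsplit] at hb
  -- the S₀ / ρ forms
  have hS0 : ∑ a ∈ range (m + 1), (m.choose a : ℚ) / ((m + u + 0 + a).choose (a + 0) : ℚ)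
      = (∑ i ∈ range (m + 1), ((2 * m + u).choose i : ℚ)) / ((2 * m + u).choose m : ℚ) := by
    rw [slice_zero_eq_rho, show m + u + m = 2 * m + u by ring]
  have hS1 : ∑ a ∈ range (m + (u + k) + 1), ((m + (u + k)).choose a : ℚ) / ((m + u + 0 + a).choose (a + 0) : ℚ)
      = (∑ i ∈ range (m + (u + k) + 1), ((2 * (m + u) + k).choose i : ℚ))
          / ((2 * (m + u) + k).choose (m + (u + k)) : ℚ) := by
    rw [slice_zero_eq_rho, show m + u + (m + (u + k)) = 2 * (m + u) + k by ring]
  -- Φ with the same denominator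
  have hphi : phiK (m + u + k) (m + u)
      = (∑ i ∈ Ioo (m + u) (m + (u + k)), ((2 * (m + u) + k).choose i : ℚ))
          / ((2 * (m + u) + k).choose (m + (u + k)) : ℚ) := by
    unfold phiK
    rw [show m + u + k + (m + u) = 2 * (m + u) + k by ring, show m + u + k = m + (u + k) by ring]
  have hsym : ((2 * (m + u) + k).choose (m + (u + k)) : ℚ) = ((2 * (m + u) + k).choose (m + u) : ℚ) := by
    rw [show 2 * (m + u) + k = (m + u) + (m + (u + k)) by ring, Nat.choose_symm_add]
  have hnum := sum_choose_split_middle (2 * (m + u) + k) (m + u) k hk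
  rw [show m + u + k = m + (u + k) by ring] at hnum
  have hCpos : (0 : ℚ) < ((2 * (m + u) + k).choose (m + u) : ℚ) := by exact_mod_cast Nat.choose_pos (by omega)
  rw [hS0, hS1, hsym] at hb
  rw [hphi, hsym]
  have key : (∑ i ∈ range (m + (u + k) + 1), ((2 * (m + u) + k).choose i : ℚ)) / ((2 * (m + u) + k).choose (m + u) : ℚ)
        - (∑ i ∈ Ioo (m + u) (m + (u + k)), ((2 * (m + u) + k).choose i : ℚ)) / ((2 * (m + u) + k).choose (m + u) : ℚ)
      = 1 + (∑ i ∈ range (m + u + 1), ((2 * (m + u) + k).choose i : ℚ)) / ((2 * (m + u) + k).choose (m + u) : ℚ) := by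
    rw [← sub_div, hnum, hsym, add_div, div_self hCpos.ne']
    ring
  linarith [hb, key]

/-- **Every slice from its tail**: `T_u ≤ 1 + ρ(2q+k, q) − ρ(2m+u, m)` ⇒ `Φ(q+k, q) ≤ R̂(q, k, m)` (`q = m + u`, `k ≥ 1`). -/
theorem phiK_le_rhat_of_sliceTail (u k m : ℕ) (hk : 1 ≤ k)
    (h : sliceTail u k m
      ≤ 1 + (∑ i ∈ range (m + u + 1), ((2 * (m + u) + k).choose i : ℚ)) / ((2 * (m + u) + k).choose (m + u) : ℚ)
        - (∑ i ∈ range (m + 1), ((2 * m + u).choose i : ℚ)) / ((2 * m + u).choose m : ℚ)) :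
    phiK (m + u + k) (m + u) ≤ rhat (m + u) k m := by
  have hid := slice_sub_phiK_eq u k m hk
  have hL := sliceLower_le_rhat u k m
  linarith [hid, hL, h]

/-- On the untruncated slices `u ≥ k − 1`, `R̂(q, k, m) = L_u` (`rhat_untrunc_eq`, p4). -/
lemma rhat_eq_sliceLower_of_untrunc (u k m : ℕ) (hu : k - 1 ≤ u) : rhat (m + u) k m = sliceLower u k m := by
  rw [rhat_untrunc_eq (m + u) k m (by omega)]
  unfold sliceLower
  rw [show m + u + k - m = u + k by omega]
  refine Finset.sum_congr rfl (fun j _ => ?_)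
  rw [Finset.mul_sum]
  refine Finset.sum_congr rfl (fun a _ => ?_)
  rw [show m + u + (j + a) = m + u + j + a by ring, show j + a = a + j by ring]
  ring

/-- **THE EXACT IDENTITY ON THE UNTRUNCATED SLICES** `u ≥ k − 1` (`k ≥ 1`, `q = m + u`):
`R̂(q, k, m) − Φ(q+k, q) = 1 + ρ(2q+k, q) − ρ(2m+u, m) − T_u`. -/
theorem rhat_sub_phiK_eq_of_untrunc (u k m : ℕ) (hk : 1 ≤ k) (hu : k - 1 ≤ u) :
    rhat (m + u) k m - phiK (m + u + k) (m + u)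
      = 1 + (∑ i ∈ range (m + u + 1), ((2 * (m + u) + k).choose i : ℚ)) / ((2 * (m + u) + k).choose (m + u) : ℚ)
        - (∑ i ∈ range (m + 1), ((2 * m + u).choose i : ℚ)) / ((2 * m + u).choose m : ℚ)
        - sliceTail u k m := by
  rw [rhat_eq_sliceLower_of_untrunc u k m hu]
  exact slice_sub_phiK_eq u k m hk

end PercRepro
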